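import Mathlib

/-!
# BlockLatticeFSum — kernel ENGINE: the lattice f-sum identity on the block torus `(ℤ/K)³`

Abstract, state-independent form of the identity that makes `ShellBudget` true (decomp-a2c lens-6
g22, node `BlockLatticeFSum`). For ANY "Gram function" `G B B'` (in the application
`G B B' = ⟨u_B, γ_Ψ u_{B'}⟩`, `u_B` the normalised block indicators) define the block-wave occupation
`nf G q = K⁻³ Σ_{B,B'} χ_q(B' − B) G B B'` (`= ⟨f_q, γ f_q⟩`, `χ_q(r) = ∏_j e^{2πi q_j r_j/K}`) and the
double-block occupation `nD G B j = (G B B + G B⁺B⁺ + G B B⁺ + G B⁺ B)/2`, `B⁺ = B + e_j`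
(`= ⟨u_{D(B,j)}, γ u_{D(B,j)}⟩`, `u_D = (u_B + u_{B⁺})/√2`). Then, with the lattice weights
`w_j(q) = 1 − (χ(q_j) + χ(−q_j))/2 = 1 − cos(2πq_j/K)` and `ε(q) = Σ_j w_j(q)`:

* `fsum_axis`  : `Σ_q w_j(q)·nf G q = Σ_B G B B − (Σ_B G B B⁺ + Σ_B G B⁺ B)/2`;
* `fsum_axis_doubleBlock` : `Σ_q w_j(q)·nf G q + Σ_B nD G B j = 2 Σ_B G B B`;
* `fsum_total` : `Σ_q ε(q)·nf G q + Σ_j Σ_B nD G B j = 6 Σ_B G B B`;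
* `fsum_total_bond` : `Σ_q ε(q)·nf G q = Σ_j Σ_B nA G B j` (antisymmetric bond modes);
* `superblock_cs`, `shellBudget_superblock`, `shellBudget_gram` : in the Gram representation
  `G B B' = ⟪w_B, w_B'⟫`, Cauchy–Schwarz inside each 2×2×2 super-block and the count over all corners
  turn super-block condensation `Σ_c ‖Σ_τ w_{c+τ}‖²/8 ≥ 8(1−η)N` into `Re Σ_q ε(q) nf q ≤ 6ηN` —
  the route's `ShellBudget` with 13595 (at block constant 2A) as the only input.

All sorry-free over Mathlib (`ZMod.stdAddChar`, `AddChar.sum_mulShift`, `ZMod.isPrimitive_stdAddChar`).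
The only input is character orthogonality `Σ_q χ_q(r) = K³·[r = 0]` (`sum_chi`).
-/

namespace Summit.AtomisticToContinuum.BoseEinsteinCondensation.Theses.BlockLatticeFSum.Engine

open scoped BigOperators

noncomputable section

variable {K : ℕ} [NeZero K]

/-- The character `χ_q(r) = ∏_j exp(2πi q_j r_j / K)` of the block torus `(ℤ/K)³`. -/
def chi (q r : Fin 3 → ZMod K) : ℂ :=
  ∏ i : Fin 3, (ZMod.stdAddChar (N := K)) (q i * r i)

/-- The unit lattice vector `e_j`. -/
def e (j : Fin 3) : Fin 3 → ZMod K := Pi.single j 1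

/-- Lattice weight `w_j(q) = 1 − (χ(q_j) + χ(−q_j))/2` (`= 1 − cos(2π q_j/K)`, see `w_eq`). -/
def w (j : Fin 3) (q : Fin 3 → ZMod K) : ℂ :=
  1 - ((ZMod.stdAddChar (N := K)) (q j) + (ZMod.stdAddChar (N := K)) (-(q j))) / 2

/-- `ε(q) = Σ_j w_j(q)`. -/
def eps (q : Fin 3 → ZMod K) : ℂ := ∑ j : Fin 3, w j q

/-- Block-wave occupation `⟨f_q, γ f_q⟩` in terms of the Gram function. -/
def nf (G : (Fin 3 → ZMod K) → (Fin 3 → ZMod K) → ℂ) (q : Fin 3 → ZMod K) : ℂ :=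
  (((K : ℂ) ^ 3)⁻¹) * ∑ B : Fin 3 → ZMod K, ∑ B' : Fin 3 → ZMod K, chi q (B' - B) * G B B'

/-- Double-block occupation `⟨u_{D(B,j)}, γ u_{D(B,j)}⟩`, `u_D = (u_B + u_{B+e_j})/√2`. -/
def nD (G : (Fin 3 → ZMod K) → (Fin 3 → ZMod K) → ℂ) (B : Fin 3 → ZMod K) (j : Fin 3) : ℂ :=
  (G B B + G (B + e j) (B + e j) + G B (B + e j) + G (B + e j) B) / 2

/-! ### Character calculus -/

/-- Shifting the argument by `c` in coordinate `j` multiplies `χ_q` by the one-dimensional character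
value `ψ(q_j c)`. -/
theorem chi_add_single (q s : Fin 3 → ZMod K) (j : Fin 3) (c : ZMod K) :
    chi q (s + Pi.single j c) = chi q s * (ZMod.stdAddChar (N := K)) (q j * c) := by
  classical
  unfold chi
  have hterm : ∀ i : Fin 3, (ZMod.stdAddChar (N := K)) (q i * (s + Pi.single j c : Fin 3 → ZMod K) i)
      = (ZMod.stdAddChar (N := K)) (q i * s i) *
          (if i = j then (ZMod.stdAddChar (N := K)) (q j * c) else 1) := by
    intro i
    by_cases h : i = j
    · subst h
      simp [mul_add, AddChar.map_add_eq_mul]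
    · simp [h]
  rw [Finset.prod_congr rfl (fun i _ => hterm i), Finset.prod_mul_distrib, Finset.prod_ite_eq']
  simp

/-- Character orthogonality on the block torus: `Σ_q χ_q(r) = K³·[r = 0]`. -/
theorem sum_chi (r : Fin 3 → ZMod K) :
    ∑ q : Fin 3 → ZMod K, chi q r = if r = 0 then (K : ℂ) ^ 3 else 0 := by
  classical
  have h1 : ∑ q : Fin 3 → ZMod K, chi q r
      = ∏ i : Fin 3, ∑ x : ZMod K, (ZMod.stdAddChar (N := K)) (x * r i) := by
    unfold chi
    rw [Finset.prod_univ_sum, Fintype.piFinset_univ]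
  have h2 : ∀ i : Fin 3, ∑ x : ZMod K, (ZMod.stdAddChar (N := K)) (x * r i)
      = if r i = 0 then (K : ℂ) else 0 := by
    intro i
    rw [AddChar.sum_mulShift (r i) (ZMod.isPrimitive_stdAddChar K), ZMod.card]
    split_ifs <;> simp
  rw [h1]
  simp_rw [h2]
  split_ifs with hr
  · subst hr
    simp
  · obtain ⟨i, hi⟩ := Function.ne_iff.mp hr
    have hi' : r i ≠ 0 := by simpa using hi
    exact Finset.prod_eq_zero (Finset.mem_univ i) (by simp [hi'])

/-- The weighted character sum: `Σ_q w_j(q) χ_q(s) = K³([s=0] − ([s+e_j=0] + [s−e_j=0])/2)`. -/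
theorem sum_w_chi (j : Fin 3) (s : Fin 3 → ZMod K) :
    ∑ q : Fin 3 → ZMod K, w j q * chi q s
      = (K : ℂ) ^ 3 * ((if s = 0 then 1 else 0)
          - ((if s + e j = 0 then 1 else 0) + (if s - e j = 0 then 1 else 0)) / 2) := by
  classical
  have hplus : ∀ q : Fin 3 → ZMod K,
      (ZMod.stdAddChar (N := K)) (q j) * chi q s = chi q (s + e j) := by
    intro q
    rw [e, chi_add_single, mul_one, mul_comm]
  have hminus : ∀ q : Fin 3 → ZMod K,
      (ZMod.stdAddChar (N := K)) (-(q j)) * chi q s = chi q (s - e j) := by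
    intro q
    have : s - e j = s + Pi.single j (-1 : ZMod K) := by
      rw [e, Pi.single_neg, ← sub_eq_add_neg]
    rw [this, chi_add_single, mul_neg_one, mul_comm]
  have hexp : ∀ q : Fin 3 → ZMod K, w j q * chi q s
      = chi q s - (chi q (s + e j) + chi q (s - e j)) / 2 := by
    intro q
    rw [← hplus q, ← hminus q]
    unfold w
    ring
  simp_rw [hexp]
  rw [Finset.sum_sub_distrib, ← Finset.sum_div, Finset.sum_add_distrib, sum_chi, sum_chi, sum_chi]
  split_ifs <;> ring

/-! ### The f-sum identity -/

/-- A sum against the indicator of a predicate that holds exactly at `t` picks out `g t`. -/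
private theorem sum_mul_indicator (g : (Fin 3 → ZMod K) → ℂ) (t : Fin 3 → ZMod K)
    (P : (Fin 3 → ZMod K) → Prop) [DecidablePred P] (h : ∀ x, P x ↔ x = t) :
    ∑ x : Fin 3 → ZMod K, g x * (if P x then (1 : ℂ) else 0) = g t := by
  classical
  have : ∀ x, (g x * if P x then (1 : ℂ) else 0) = if x = t then g x else 0 := by
    intro x
    by_cases hx : x = t
    · simp [hx, (h t).mpr rfl]
    · have : ¬ P x := fun hp => hx ((h x).mp hp)
      simp [hx, this]
  simp_rw [this]
  simp

/-- **Lattice f-sum identity, one axis.** -/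
theorem fsum_axis (G : (Fin 3 → ZMod K) → (Fin 3 → ZMod K) → ℂ) (j : Fin 3) :
    ∑ q : Fin 3 → ZMod K, w j q * nf G q
      = ∑ B : Fin 3 → ZMod K, G B B
        - ((∑ B : Fin 3 → ZMod K, G B (B + e j)) + ∑ B : Fin 3 → ZMod K, G (B + e j) B) / 2 := by
  classical
  have hK : ((K : ℂ) ^ 3) ≠ 0 := pow_ne_zero _ (Nat.cast_ne_zero.mpr (NeZero.ne K))
  -- expand and exchange the sums
  have step1 : ∑ q : Fin 3 → ZMod K, w j q * nf G q
      = (((K : ℂ) ^ 3)⁻¹) * ∑ B : Fin 3 → ZMod K, ∑ B' : Fin 3 → ZMod K,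
          G B B' * ∑ q : Fin 3 → ZMod K, w j q * chi q (B' - B) := by
    unfold nf
    simp_rw [Finset.mul_sum]
    rw [Finset.sum_comm]
    refine Finset.sum_congr rfl fun B _ => ?_
    rw [Finset.sum_comm]
    refine Finset.sum_congr rfl fun B' _ => ?_
    refine Finset.sum_congr rfl fun q _ => ?_
    ring
  rw [step1]
  simp_rw [sum_w_chi]
  -- evaluate the three indicator sums in B'
  have hA : ∀ B : Fin 3 → ZMod K,
      ∑ B' : Fin 3 → ZMod K, G B B' * (if B' - B = 0 then (1 : ℂ) else 0) = G B B := fun B =>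
    sum_mul_indicator (G B) B _ (fun x => sub_eq_zero)
  have hP : ∀ B : Fin 3 → ZMod K,
      ∑ B' : Fin 3 → ZMod K, G B B' * (if B' - B + e j = 0 then (1 : ℂ) else 0) = G B (B - e j) :=
    fun B => sum_mul_indicator (G B) (B - e j) _ (fun x => by
      rw [show x - B + e j = x - (B - e j) by abel, sub_eq_zero])
  have hM : ∀ B : Fin 3 → ZMod K,
      ∑ B' : Fin 3 → ZMod K, G B B' * (if B' - B - e j = 0 then (1 : ℂ) else 0) = G B (B + e j) :=
    fun B => sum_mul_indicator (G B) (B + e j) _ (fun x => by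
      rw [show x - B - e j = x - (B + e j) by abel, sub_eq_zero])
  have hlin : ∀ g a b c : ℂ,
      ((K : ℂ) ^ 3)⁻¹ * (g * ((K : ℂ) ^ 3 * (a - (b + c) / 2))) = g * a - (g * b + g * c) / 2 := by
    intro g a b c
    rw [mul_left_comm g, ← mul_assoc, inv_mul_cancel₀ hK, one_mul]
    ring
  simp_rw [Finset.mul_sum, hlin, Finset.sum_sub_distrib, ← Finset.sum_div, Finset.sum_add_distrib,
    hA, hP, hM]
  -- reindex `Σ_B G B (B - e j) = Σ_B G (B + e j) B`
  have hre : ∑ B : Fin 3 → ZMod K, G B (B - e j) = ∑ B : Fin 3 → ZMod K, G (B + e j) B := by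
    refine Fintype.sum_equiv (Equiv.subRight (e j)) _ _ fun B => ?_
    simp [Equiv.subRight]
  rw [hre, add_comm (∑ B : Fin 3 → ZMod K, G (B + e j) B)]

/-- **Lattice f-sum identity, double-block form, one axis:**
`Σ_q w_j(q)·⟨f_q,γf_q⟩ + Σ_B ⟨u_{D(B,j)},γu_{D(B,j)}⟩ = 2·Σ_B ⟨u_B,γu_B⟩`. -/
theorem fsum_axis_doubleBlock (G : (Fin 3 → ZMod K) → (Fin 3 → ZMod K) → ℂ) (j : Fin 3) :
    ∑ q : Fin 3 → ZMod K, w j q * nf G q + ∑ B : Fin 3 → ZMod K, nD G B j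
      = 2 * ∑ B : Fin 3 → ZMod K, G B B := by
  classical
  rw [fsum_axis]
  have hshift : ∑ B : Fin 3 → ZMod K, G (B + e j) (B + e j) = ∑ B : Fin 3 → ZMod K, G B B := by
    refine Fintype.sum_equiv (Equiv.addRight (e j)) _ _ fun B => ?_
    simp [Equiv.addRight]
  have h4 : ∑ B : Fin 3 → ZMod K, nD G B j
      = (∑ B : Fin 3 → ZMod K, G B B + ∑ B : Fin 3 → ZMod K, G (B + e j) (B + e j)
          + ∑ B : Fin 3 → ZMod K, G B (B + e j) + ∑ B : Fin 3 → ZMod K, G (B + e j) B) / 2 := by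
    unfold nD
    rw [← Finset.sum_div, Finset.sum_add_distrib, Finset.sum_add_distrib, Finset.sum_add_distrib]
  rw [h4, hshift]
  ring

/-- **Lattice f-sum identity (total):** `Σ_q ε(q)⟨f_q,γf_q⟩ + Σ_j Σ_B ⟨u_{D(B,j)},γu_{D(B,j)}⟩ = 6 Σ_B ⟨u_B,γu_B⟩`.
With `⟨u_B,γu_B⟩ ≤ N_B`, `Σ_B N_B = N` and, for `K` even, the six parity tilings by double blocks each
carrying `≥ (1−η)N`, this gives `Σ_q ε(q)⟨f_q,γf_q⟩ ≤ 6ηN` (`ShellBudget`). -/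
theorem fsum_total (G : (Fin 3 → ZMod K) → (Fin 3 → ZMod K) → ℂ) :
    ∑ q : Fin 3 → ZMod K, eps q * nf G q + ∑ j : Fin 3, ∑ B : Fin 3 → ZMod K, nD G B j
      = 6 * ∑ B : Fin 3 → ZMod K, G B B := by
  classical
  have : ∑ q : Fin 3 → ZMod K, eps q * nf G q
      = ∑ j : Fin 3, ∑ q : Fin 3 → ZMod K, w j q * nf G q := by
    unfold eps
    simp_rw [Finset.sum_mul]
    rw [Finset.sum_comm]
  rw [this, ← Finset.sum_add_distrib]
  simp_rw [fsum_axis_doubleBlock]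
  rw [Finset.sum_const, Finset.card_univ, Fintype.card_fin, nsmul_eq_mul]
  push_cast
  ring

/-- **Shell budget (abstract real form).** If the Gram diagonal is dominated by particle numbers
`G B B ≤ N_B` with `Σ_B N_B = N`, and the double-block occupations of the six families
`(j, parity p)` each sum to at least `(1 − η)N`, then the `ε`-weighted block-wave occupation is at most
`6ηN`. (Stated with real-valued `nfR, nDR, d` standing for `nf, nD, G B B` and the identity
`fsum_total` as hypothesis `hid`, so that it applies verbatim to the real parts.) -/
theorem shellBudget_abstract {ι κ : Type*} [Fintype ι] [Fintype κ]
    (epsR nfR : κ → ℝ) (d Nb : ι → ℝ) (fam : Fin 6 → Finset ι) (nDR : Fin 6 → ι → ℝ)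
    (N η : ℝ)
    (hid : ∑ q, epsR q * nfR q + ∑ a : Fin 6, ∑ B ∈ fam a, nDR a B = 6 * ∑ B, d B)
    (hdiag : ∀ B, d B ≤ Nb B) (hN : ∑ B, Nb B = N)
    (hfam : ∀ a : Fin 6, (1 - η) * N ≤ ∑ B ∈ fam a, nDR a B) :
    ∑ q, epsR q * nfR q ≤ 6 * η * N := by
  have h1 : ∑ B, d B ≤ N := hN ▸ Finset.sum_le_sum fun B _ => hdiag B
  have h2 : 6 * ((1 - η) * N) ≤ ∑ a : Fin 6, ∑ B ∈ fam a, nDR a B := by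
    calc 6 * ((1 - η) * N) = ∑ _a : Fin 6, (1 - η) * N := by simp
      _ ≤ ∑ a : Fin 6, ∑ B ∈ fam a, nDR a B := Finset.sum_le_sum fun a _ => hfam a
  linarith

/-- **Shell Chebyshev (abstract).** From the budget, every shell `{ε ≥ θ}` carries at most
`budget/θ`. -/
theorem shell_chebyshev {κ : Type*} [Fintype κ] (epsR nfR : κ → ℝ) (θ S : ℝ) (hθ : 0 < θ)
    (heps : ∀ q, 0 ≤ epsR q) (hnf : ∀ q, 0 ≤ nfR q) (hS : ∑ q, epsR q * nfR q ≤ S) :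
    ∑ q ∈ Finset.univ.filter (fun q => θ ≤ epsR q), nfR q ≤ S / θ := by
  classical
  rw [le_div_iff₀ hθ]
  calc (∑ q ∈ Finset.univ.filter (fun q => θ ≤ epsR q), nfR q) * θ
      = ∑ q ∈ Finset.univ.filter (fun q => θ ≤ epsR q), nfR q * θ := Finset.sum_mul _ _ _
    _ ≤ ∑ q ∈ Finset.univ.filter (fun q => θ ≤ epsR q), epsR q * nfR q := by
        refine Finset.sum_le_sum fun q hq => ?_
        rw [Finset.mem_filter] at hq
        rw [mul_comm]
        exact mul_le_mul_of_nonneg_right hq.2 (hnf q)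
    _ ≤ ∑ q, epsR q * nfR q :=
        Finset.sum_le_sum_of_subset_of_nonneg (Finset.filter_subset _ _)
          (fun q _ _ => mul_nonneg (heps q) (hnf q))
    _ ≤ S := hS


end

end Summit.AtomisticToContinuum.BoseEinsteinCondensation.Theses.BlockLatticeFSum.Engine
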